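import Literature.NumberTheory.EllipticCurves.LocalPointsFiniteIndexLattice
import Literature.NumberTheory.EllipticCurves.LocalFieldPointsZpLatticeProofs
import Literature.NumberTheory.EllipticCurves.Kobayashi2003.LocalLayerFieldProofs
import Literature.NumberTheory.GaloisRepresentations.LocalFieldFiniteExtension
import Literature.NumberTheory.Automorphic.AdicCompletionLocalField
import HarnessLib

/-!
# Silverman AEC VII Prop. 6.3 (with IV Thm. 6.4 (b)) on the local layers `E(K_n·K_v)` — DISCHARGED:
# `silvermanVII63_localLayerPoints_finiteIndex_zpLattice_holds`

`Proofs` file (theorems only; no definition, no named fact, no instance) in topic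
`NumberTheory/EllipticCurves`, the `_holds` companion of `LocalPointsFiniteIndexLattice.lean` (the named
fact `silvermanVII63_localLayerPoints_finiteIndex_zpLattice`, p656226, stated there VERBATIM from
J. H. Silverman, *The Arithmetic of Elliptic Curves*, 2nd ed., VII Prop. 6.3 with IV Thm. 6.4 (b) on the
tree's carrier `Kobayashi2003.localLayerPointsOfEmb`; statement untouched). Net Literature debt `−1`.

## The proof (Silverman's, assembled from tree theorems)

For a number field `K`, a prime `p`, a `ℤ_p`-extension `κ`, a place `v ∋ p`, an embedding
`ι : K̄ → K̄_v`, an elliptic curve `W/K` and `n : ℕ`, put `G = Gal(K̄_v/K_n·K_v) =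
localLayerSubgroupOfEmb κ ι n ≤ Γ_{K_v}` (open of finite index) and let `L = K̄_v^G = K_n·K_v` be its
fixed field (Mathlib `IntermediateField.fixedField`, along the identity `Γ_{K_v} = (K̄_v ≃ₐ K̄_v)`):

1. `L/K_v` is finite of degree `[Γ_{K_v} : G]` and `E(K_n·K_v) = localLayerPointsOfEmb κ ι W n ≃+ E_W(L)`
   by Galois descent (`Kobayashi2003/LocalLayerFieldProofs`);
2. `L` is a non-archimedean local field for the prolonged absolute value (tree
   `GaloisRepresentations/LocalFieldFiniteExtension`: `FiniteExtension.isNonarchimedeanLocalField`) and a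
   `ℚ_p`-algebra of dimension `[L : ℚ_p] = [L : K_v]·[K_v : ℚ_p] = G.index · e(v|p) f(v|p)` for the
   canonical continuous `ℚ_p → K_v` (tree `LocalField.adicCompletionPadicAlgebra`,
   `finrank_adicCompletionPadicAlgebra_eq`; `Kobayashi2003.finrank_padic_layerField_eq`);
3. **Silverman VII.6.3 over `L`** (`LocalFieldPoints.exists_finiteIndex_addEquiv_padicInt_pi`,
   file `LocalFieldPointsZpLatticeProofs`: `𝒪[L]`-model, `[E : E₁] < ∞` algebraically (VII.6.2 /
   Exercise 7.6), `[E₁ : U_{|p|²}] < ∞` (IV.3.2 (a)), `U_{|p|²} ≃+ p²𝒪_L` by the formal logarithm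
   (IV.6.4 (b)), `𝒪_L ≃+ ℤ_p^{[L:ℚ_p]}` (Neukirch II (5.7))): `E_W(L) ⊇ U` of finite index,
   `U ≃+ ℤ_p^{[L:ℚ_p]}`;
4. transport `U` into `localLayerPointsOfEmb κ ι W n` along the isomorphism of step 1.

HONEST FRAMING: proving this input makes its consumers (`Sprung2012.…_of_silvermanVII63`, p659344;
the bridge `Theorems/PrintX8VSKatoFineLowerSporadicX8LocalLayerZpLatticeSurjection`, p658454 → x8 items
stmt-BirchSwinnertonDyer-22569 / -22901 → 19875) unconditional in this one hypothesis AS TYPED and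
nothing more; no summit statement is proved here; BSD is NOT proved by any of this. Unit
`bsd-inputs-vii63-p1` (INPUTS desk, LADDER-BSD inputs→unconditional).

## References
* [SilvermanAEC2009] J. H. Silverman, *The Arithmetic of Elliptic Curves*, 2nd ed., GTM 106 (2009):
  VII Prop. 6.3 (held scan p0178 L1–L12), Cor. VII.6.2 / Exercise 7.6, Prop. VII.2.2, Prop. IV.3.2 (a),
  Thm. IV.6.4 (b) (p0122), VIII §1.
* [NeukirchANT1999] J. Neukirch, *Algebraic Number Theory* (1999), Ch. II (5.7), (8.5); Ch. IV (1.1).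
* [Kobayashi2003] S. Kobayashi, Invent. Math. 152 (2003), Def. 1.1.
* [Sprung2012] F. Sprung, J. Number Theory 132 (2012), Lemma 2.3 (p. 1488).
-/

noncomputable section

open scoped Classical

open NumberField IsDedekindDomain Field
open Literature.NumberTheory.GaloisRepresentations

namespace Literature.NumberTheory.EllipticCurves

/-- Transport of "a finite-index subgroup `U ≃+ X`" along an isomorphism `e : A ≃+ ↥M` onto a
subgroup `M` of an ambient group `B`: the image `H = U^e ≤ M ≤ B` has finite index in `M` and
`H ≃+ X` (bookkeeping). [folklore] -/
private theorem exists_le_finiteIndex_addEquiv_of_addEquiv {A B X : Type*} [AddCommGroup A]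
    [AddCommGroup B] [AddCommGroup X] (M : AddSubgroup B) (e : A ≃+ M)
    (h : ∃ U : AddSubgroup A, U.FiniteIndex ∧ Nonempty (U ≃+ X)) :
    ∃ H : AddSubgroup B, H ≤ M ∧ (H.addSubgroupOf M).FiniteIndex ∧ Nonempty (H ≃+ X) := by
  obtain ⟨U, hU, ⟨eU⟩⟩ := h
  haveI := hU
  refine ⟨(U.map (e : A →+ M)).map M.subtype, AddSubgroup.map_subtype_le _, ?_, ?_⟩
  · rw [AddSubgroup.addSubgroupOf, AddSubgroup.comap_map_eq_self_of_injective M.subtype_injective]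
    exact ⟨by rw [AddSubgroup.index_map_equiv]; exact AddSubgroup.FiniteIndex.index_ne_zero⟩
  · exact ⟨((U.map (e : A →+ M)).equivMapOfInjective M.subtype M.subtype_injective).symm.trans
      ((e.addSubgroupMap U).symm.trans eU)⟩

/-- `LocalFieldPoints.exists_finiteIndex_addEquiv_padicInt_pi` (Silverman VII.6.3 with
`R⁺ ≅ ℤ_p^{[F:ℚ_p]}`, file `LocalFieldPointsZpLatticeProofs`) for an ARBITRARY `DecidableEq` instance on
`F` in Mathlib's group law on `W.toAffine.Point` (the engine file works with the classical instance; a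
fixed field inside `K̄_v` carries the subtype instance — all such instances are equal, `Subsingleton.elim`).
[cite: SilvermanAEC2009, Prop. VII.6.3 and Thm. IV.6.4 (b)] -/
theorem LocalFieldPoints.exists_finiteIndex_addEquiv_padicInt_pi_of_decidableEq {F : Type*} [Field F]
    [DecidableEq F] [ValuativeRel F] [TopologicalSpace F] [IsNonarchimedeanLocalField F]
    (p : ℕ) [Fact p.Prime] [Algebra ℚ_[p] F] [FiniteDimensional ℚ_[p] F]
    (W : WeierstrassCurve F) [W.IsElliptic] :
    ∃ U : AddSubgroup W.toAffine.Point, U.FiniteIndex ∧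
      Nonempty (U ≃+ (Fin (Module.finrank ℚ_[p] F) → ℤ_[p])) := by
  obtain rfl : ‹DecidableEq F› = fun a b ↦ Classical.propDecidable (a = b) := Subsingleton.elim _ _
  exact LocalFieldPoints.exists_finiteIndex_addEquiv_padicInt_pi p W

/-- **Silverman, *AEC* VII Prop. 6.3 (with IV Thm. 6.4 (b)) on the local layers — the named fact
`silvermanVII63_localLayerPoints_finiteIndex_zpLattice` DISCHARGED.** For every number field `K`, prime
`p`, `ℤ_p`-extension `κ` of `K`, finite place `v ∋ p`, `K`-embedding `ι : K̄ → K̄_{K_v}`, elliptic curve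
`W/K` and `n`, the layer points `E(K_n·K_v) = localLayerPointsOfEmb κ ι W n` contain a subgroup `H` of
finite index with `H ≃+ ℤ_p^d`, `d = [K_n·K_v : K_v] · e(v|p) f(v|p) = [K_n·K_v : ℚ_p]`. Proof: Galois
descent to the layer field `L = K_n·K_v` (a finite extension of the local field `K_v`, itself a local
field), Silverman VII.6.3 over `L` (`LocalFieldPoints.exists_finiteIndex_addEquiv_padicInt_pi`), and
`[L : ℚ_p] = [L : K_v]·e f`. [cite: SilvermanAEC2009, VII Prop. 6.3 and IV Thm. 6.4 (b) (held scan p0178 L1–L12, p0122)]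
[cite: NeukirchANT1999, Ch. II (5.7) and (8.5)] [cite: Sprung2012, Lemma 2.3 (p. 1488)] -/
theorem silvermanVII63_localLayerPoints_finiteIndex_zpLattice_holds :
    silvermanVII63_localLayerPoints_finiteIndex_zpLattice := by
  intro K _ _ p _ κ v hv ι W _ n
  haveI : CharZero (v.adicCompletion K) := LocalField.charZero_adicCompletion v
  -- the layer field `L = K̄_v^{Gal(K̄_v/K_n·K_v)}`, finite over `K_v`
  haveI := Kobayashi2003.finiteDimensional_layerField κ ι (E := v.adicCompletion K) n
  -- `L` is a non-archimedean local field (prolonged absolute value)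
  letI := FiniteExtension.valuativeRel (v.adicCompletion K)
    (IntermediateField.fixedField ((Kobayashi2003.localLayerSubgroupOfEmb κ ι n).comap
      (absoluteGaloisGroup.toAlgEquiv (v.adicCompletion K)).symm.toMonoidHom))
  letI := FiniteExtension.topologicalSpace (v.adicCompletion K)
    (IntermediateField.fixedField ((Kobayashi2003.localLayerSubgroupOfEmb κ ι n).comap
      (absoluteGaloisGroup.toAlgEquiv (v.adicCompletion K)).symm.toMonoidHom))
  haveI := FiniteExtension.isNonarchimedeanLocalField (v.adicCompletion K)
    (IntermediateField.fixedField ((Kobayashi2003.localLayerSubgroupOfEmb κ ι n).comap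
      (absoluteGaloisGroup.toAlgEquiv (v.adicCompletion K)).symm.toMonoidHom))
  -- the canonical `ℚ_p`-structure on `K_v` (hence on `K̄_v` and on `L`, Mathlib `AlgebraicClosure.instAlgebra`,
  -- `IntermediateField.algebra'`)
  letI : Algebra ℚ_[p] (v.adicCompletion K) := LocalField.adicCompletionPadicAlgebra v p hv
  haveI : FiniteDimensional ℚ_[p] (v.adicCompletion K) := by
    apply Module.finite_of_finrank_pos
    rw [Literature.NumberTheory.NumberFields.finrank_adicCompletionPadicAlgebra_eq p v hv]
    exact Nat.mul_pos (Ideal.ramificationIdx_pos _ _) (Ideal.inertiaDeg_pos _ _)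
  haveI : FiniteDimensional ℚ_[p]
      (IntermediateField.fixedField ((Kobayashi2003.localLayerSubgroupOfEmb κ ι n).comap
        (absoluteGaloisGroup.toAlgEquiv (v.adicCompletion K)).symm.toMonoidHom)) :=
    Module.Finite.trans (v.adicCompletion K) _
  have hd := Kobayashi2003.finrank_padic_layerField_eq κ v ι hv n
    (LocalField.continuous_algebraMap_adicCompletionPadicAlgebra v p hv)
  -- Silverman VII.6.3 over the local field `L`
  haveI : (W.baseChange (IntermediateField.fixedField ((Kobayashi2003.localLayerSubgroupOfEmb κ ι n).comap
      (absoluteGaloisGroup.toAlgEquiv (v.adicCompletion K)).symm.toMonoidHom))).IsElliptic := by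
    rw [WeierstrassCurve.baseChange]; infer_instance
  obtain ⟨U, hU, ⟨eU⟩⟩ := LocalFieldPoints.exists_finiteIndex_addEquiv_padicInt_pi_of_decidableEq p
    (W.baseChange (IntermediateField.fixedField ((Kobayashi2003.localLayerSubgroupOfEmb κ ι n).comap
      (absoluteGaloisGroup.toAlgEquiv (v.adicCompletion K)).symm.toMonoidHom)))
  rw [hd] at eU
  -- transport along `E_W(L) ≃+ E(K_n·K_v)`
  obtain ⟨e⟩ := Kobayashi2003.nonempty_point_layerField_addEquiv_localLayerPointsOfEmb κ ι W n
  exact exists_le_finiteIndex_addEquiv_of_addEquiv _ e ⟨U, hU, ⟨eU⟩⟩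

end Literature.NumberTheory.EllipticCurves

end
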